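import Summits.ABC.ABC.Theorems.SomeWindowSaving.Negative.WindowFinite
import Summits.ABC.ABC.Theorems.SomeWindowSaving.Negative.TwistCovariants

/-!
# The `j = 0` family `y² = x³ + ℓ⁵`: minimal model and conductor

Negative-side support for the crux `TwistAmplification.SomeWindowSaving` (stmt-ABC-1976), cdisprove
gen 3, HYPOTHESIS MUTATION of the CM-j exclusion `c₄ ≠ 0 ∧ c₆ ≠ 0`: the reduced integral models
`cmFamily ℓ = ⟨0, 0, 0, 0, ℓ⁵⟩` (`ℓ ≥ 5` prime) have `c₄ = 0` (so `j = 0`: excluded by the crux),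
`Δ = −432 ℓ¹⁰`, are minimal at every place (`v_p(Δ) < 12`), and have conductor `N` with
`ℓ² ∣ N ∣ 432 ℓ²` (`f_ℓ = 2` by tameness, `f₂ ≤ v₂(Δ) = 4`, `f₃ ≤ v₃(Δ) = 3`, Ogg–Saito via the
tree's `conductorExponent_lt_of_not_pow_dvd`).  Hence generalized-Szpiro ratio
`log(432 ℓ¹⁰)/log N → 5`.  Also the DEFINITIONS of the mutated window set `windowSetCM`
(the crux's set-builder without `c₄ ≠ 0 ∧ c₆ ≠ 0`) and of the mutated crux
`SomeWindowSavingWithoutCM`; the theorems about them are in `Negative/CMExclusion.lean`.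
-/

noncomputable section

open UniqueFactorizationMonoid IsDedekindDomain Real WeierstrassCurve Rat.HeightOneSpectrum
open Literature.NumberTheory.EllipticCurves

namespace Summit.ABC.ABC.Theorems.SomeWindowSaving.Negative

section CMFamily

variable {ℓ : ℕ}

/-- `y² = x³ + ℓ⁵` as a reduced integral model (`a₁ = a₂ = a₃ = a₄ = 0`). -/
def cmFamily (ℓ : ℕ) : WeierstrassCurve ℤ := ⟨0, 0, 0, 0, (ℓ : ℤ) ^ 5⟩

/-- `c₄ = 0` (`j = 0`). -/
theorem cmFamily_c₄ (ℓ : ℕ) : (cmFamily ℓ).c₄ = 0 := by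
  simp only [cmFamily, WeierstrassCurve.c₄, WeierstrassCurve.b₂, WeierstrassCurve.b₄]; ring

/-- `c₆ = −864 ℓ⁵`. -/
theorem cmFamily_c₆ (ℓ : ℕ) : (cmFamily ℓ).c₆ = -(864 * (ℓ : ℤ) ^ 5) := by
  simp only [cmFamily, WeierstrassCurve.c₆, WeierstrassCurve.b₂, WeierstrassCurve.b₄,
    WeierstrassCurve.b₆]; ring

/-- `Δ = −432 ℓ¹⁰`. -/
theorem cmFamily_Δ (ℓ : ℕ) : (cmFamily ℓ).Δ = -(432 * (ℓ : ℤ) ^ 10) := by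
  simp only [cmFamily, WeierstrassCurve.Δ, WeierstrassCurve.b₂, WeierstrassCurve.b₄,
    WeierstrassCurve.b₆, WeierstrassCurve.b₈]; ring

/-- `a₆ = ℓ⁵` pins `ℓ`: the family is injective. -/
theorem cmFamily_injective : Function.Injective cmFamily := by
  intro ℓ ℓ' h
  have h6 : ((ℓ : ℤ)) ^ 5 = ((ℓ' : ℤ)) ^ 5 := by
    have := congrArg WeierstrassCurve.a₆ h
    simpa [cmFamily] using this
  have : (ℓ : ℤ) = ℓ' := (pow_left_inj₀ (by positivity) (by positivity) (by norm_num)).mp h6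
  exact_mod_cast this

/-- `cmFamily ℓ ⊗ ℚ` is an elliptic curve for `ℓ ≠ 0`. -/
theorem isElliptic_cmFamily (hℓ : ℓ ≠ 0) : ((cmFamily ℓ).baseChange ℚ).IsElliptic := by
  refine ⟨?_⟩
  rw [baseChange_int_Δ, cmFamily_Δ, isUnit_iff_ne_zero]
  have h : -(432 * (ℓ : ℤ) ^ 10) ≠ 0 :=
    neg_ne_zero.mpr (mul_ne_zero (by norm_num) (pow_ne_zero _ (by exact_mod_cast hℓ)))
  exact_mod_cast h

/-- A prime `ℓ ≥ 5` does not divide `432 = 2⁴ 3³`. -/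
theorem not_dvd_432 (hℓ : ℓ.Prime) (h5 : 5 ≤ ℓ) : ¬ ℓ ∣ 432 := by
  intro h
  have h' : ℓ ∣ 2 ^ 4 * 3 ^ 3 := by norm_num; exact h
  rcases (Nat.Prime.dvd_mul hℓ).mp h' with h2 | h3
  · have := (Nat.prime_dvd_prime_iff_eq hℓ Nat.prime_two).mp (hℓ.dvd_of_dvd_pow h2); omega
  · have := (Nat.prime_dvd_prime_iff_eq hℓ Nat.prime_three).mp (hℓ.dvd_of_dvd_pow h3); omega

/-- For primes `p ≠ ℓ`: `p^k ∣ 432 ℓ¹⁰` forces `p^k ∣ 432`. -/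
theorem pow_dvd_432_of_coprime {p k : ℕ} (hp : p.Prime) (hℓ : ℓ.Prime) (hpl : p ≠ ℓ)
    (h : p ^ k ∣ 432 * ℓ ^ 10) : p ^ k ∣ 432 :=
  (Nat.Coprime.pow _ _ ((Nat.coprime_primes hp hℓ).mpr hpl)).dvd_of_dvd_mul_right h

/-- For primes `p ≠ ℓ` with `432 < p^k`: `p^k ∤ 432 ℓ¹⁰`. -/
theorem not_pow_dvd_of_coprime {p k : ℕ} (hp : p.Prime) (hℓ : ℓ.Prime) (hpl : p ≠ ℓ)
    (hk : 432 < p ^ k) : ¬ p ^ k ∣ 432 * ℓ ^ 10 := fun h ↦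
  absurd (Nat.le_of_dvd (by norm_num) (pow_dvd_432_of_coprime hp hℓ hpl h)) (not_le.mpr hk)

/-- `ℓ¹² ∤ 432 ℓ¹⁰` for a prime `ℓ ≥ 5`. -/
theorem not_pow_twelve_dvd_self (hℓ : ℓ.Prime) (h5 : 5 ≤ ℓ) : ¬ ℓ ^ 12 ∣ 432 * ℓ ^ 10 := by
  intro h
  have h' : ℓ ^ 2 * ℓ ^ 10 ∣ 432 * ℓ ^ 10 := by rwa [← pow_add]
  have h2 : ℓ ^ 2 ∣ 432 := Nat.dvd_of_mul_dvd_mul_right (pow_pos hℓ.pos 10) h'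
  exact not_dvd_432 hℓ h5 (dvd_trans (dvd_pow_self ℓ two_ne_zero) h2)

/-- Transfer: `(p : ℤ)^k ∣ Δ(cmFamily ℓ)` iff `p^k ∣ 432 ℓ¹⁰` in `ℕ`. -/
theorem pow_dvd_cmFamily_Δ_iff {p k : ℕ} :
    (p : ℤ) ^ k ∣ (cmFamily ℓ).Δ ↔ p ^ k ∣ 432 * ℓ ^ 10 := by
  rw [cmFamily_Δ, dvd_neg]
  constructor
  · intro h
    have h' : ((p ^ k : ℕ) : ℤ) ∣ ((432 * ℓ ^ 10 : ℕ) : ℤ) := by push_cast; exact h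
    exact Int.natCast_dvd_natCast.mp h'
  · intro h
    have h' : ((p ^ k : ℕ) : ℤ) ∣ ((432 * ℓ ^ 10 : ℕ) : ℤ) := Int.natCast_dvd_natCast.mpr h
    push_cast at h'
    exact h'

/-- **Minimality at every place** (`v_p(Δ) < 12` for all `p`). -/
theorem isMinimalAt_cmFamily (hℓ : ℓ.Prime) (h5 : 5 ≤ ℓ) (v : HeightOneSpectrum ℤ) :
    ((cmFamily ℓ).baseChange ℚ).IsMinimalAt v := by
  refine isMinimalAt_baseChange_int_of_not_pow_dvd_Δ ?_
  set p := natGenerator v with hp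
  have hpp : p.Prime := prime_natGenerator v
  rw [pow_dvd_cmFamily_Δ_iff]
  by_cases hpl : p = ℓ
  · rw [hpl]; exact not_pow_twelve_dvd_self hℓ h5
  · refine not_pow_dvd_of_coprime hpp hℓ hpl ?_
    calc 432 < 2 ^ 12 := by norm_num
      _ ≤ p ^ 12 := Nat.pow_le_pow_left hpp.two_le 12

/-- **Conductor upper bound**: `N ∣ 2⁴ · 3³ · ℓ²` (`f₂ ≤ 4`, `f₃ ≤ 3`, `f_ℓ ≤ 2`, `f_q = 0` else). -/
theorem conductorNorm_cmFamily_dvd (hℓ : ℓ.Prime) (h5 : 5 ≤ ℓ) :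
    ((cmFamily ℓ).baseChange ℚ).conductorNorm ℤ ∣ 2 ^ 4 * 3 ^ 3 * ℓ ^ 2 := by
  haveI := isElliptic_cmFamily hℓ.ne_zero
  have hℓ2 : ℓ ≠ 2 := by omega
  have hℓ3 : ℓ ≠ 3 := by omega
  refine conductorNorm_dvd_of_forall_conductorExponent_le _ (by positivity) fun q ↦ ?_
  obtain ⟨v, hv⟩ := exists_place q
  obtain ⟨q, hq⟩ := q
  simp only at hv ⊢
  have hmin := isMinimalAt_cmFamily hℓ h5 v
  have hfℓ : (ℓ ^ 2).factorization q = if ℓ = q then 2 else 0 := by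
    rw [Nat.factorization_pow, Finsupp.smul_apply, hℓ.factorization, Finsupp.single_apply]
    split_ifs <;> simp
  have hf2 : (2 ^ 4).factorization q = if 2 = q then 4 else 0 := by
    rw [Nat.factorization_pow, Finsupp.smul_apply, Nat.prime_two.factorization, Finsupp.single_apply]
    split_ifs <;> simp
  have hf3 : (3 ^ 3).factorization q = if 3 = q then 3 else 0 := by
    rw [Nat.factorization_pow, Finsupp.smul_apply, Nat.prime_three.factorization, Finsupp.single_apply]
    split_ifs <;> simp
  rw [show (primesEquiv (R := ℤ)).symm ⟨q, hq⟩ = v from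
      (primesEquiv (R := ℤ)).symm_apply_eq.mpr (Subtype.ext hv.symm),
    Nat.factorization_mul (by positivity) (pow_ne_zero 2 hℓ.ne_zero),
    Nat.factorization_mul (by positivity) (by positivity), Finsupp.add_apply, Finsupp.add_apply,
    hfℓ, hf2, hf3]
  by_cases h2 : q = 2
  · subst h2
    have : ((cmFamily ℓ).baseChange ℚ).conductorExponent v < 5 := by
      refine conductorExponent_lt_of_not_pow_dvd hmin ?_
      rw [hv, pow_dvd_cmFamily_Δ_iff]
      exact fun h ↦ absurd (pow_dvd_432_of_coprime Nat.prime_two hℓ (Ne.symm hℓ2) h) (by decide)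
    split_ifs <;> omega
  by_cases h3 : q = 3
  · subst h3
    have : ((cmFamily ℓ).baseChange ℚ).conductorExponent v < 4 := by
      refine conductorExponent_lt_of_not_pow_dvd hmin ?_
      rw [hv, pow_dvd_cmFamily_Δ_iff]
      exact fun h ↦ absurd (pow_dvd_432_of_coprime Nat.prime_three hℓ (Ne.symm hℓ3) h) (by decide)
    split_ifs <;> omega
  by_cases hql : q = ℓ
  · subst hql
    have : ((cmFamily q).baseChange ℚ).conductorExponent v ≤ 2 :=
      conductorExponent_le_two_of_five_le_natGenerator_holds ((cmFamily q).baseChange ℚ) v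
        (by rw [hv]; exact h5)
    split_ifs <;> omega
  have : ((cmFamily ℓ).baseChange ℚ).conductorExponent v = 0 := by
    refine conductorExponent_eq_zero_of_not_dvd_Δ hmin ?_
    rw [hv, ← pow_one (q : ℤ), pow_dvd_cmFamily_Δ_iff, pow_one]
    intro h
    rcases (Nat.Prime.dvd_mul hq).mp h with h | h
    · have h' : q ∣ 2 ^ 4 * 3 ^ 3 := by norm_num; exact h
      rcases (Nat.Prime.dvd_mul hq).mp h' with h | h
      · exact h2 ((Nat.prime_dvd_prime_iff_eq hq Nat.prime_two).mp (hq.dvd_of_dvd_pow h))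
      · exact h3 ((Nat.prime_dvd_prime_iff_eq hq Nat.prime_three).mp (hq.dvd_of_dvd_pow h))
    · exact hql ((Nat.prime_dvd_prime_iff_eq hq hℓ).mp (hq.dvd_of_dvd_pow h))
  split_ifs <;> omega

/-- **Conductor lower bound**: `ℓ² ∣ N` (additive reduction at `ℓ`: `ℓ ∣ Δ`, `ℓ ∣ c₄ = 0`). -/
theorem sq_dvd_conductorNorm_cmFamily (hℓ : ℓ.Prime) (h5 : 5 ≤ ℓ) :
    ℓ ^ 2 ∣ ((cmFamily ℓ).baseChange ℚ).conductorNorm ℤ := by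
  haveI := isElliptic_cmFamily hℓ.ne_zero
  have hN0 : ((cmFamily ℓ).baseChange ℚ).conductorNorm ℤ ≠ 0 := (conductorNorm_pos_holds _).ne'
  obtain ⟨v, hv⟩ := exists_place ⟨ℓ, hℓ⟩
  simp only at hv
  have hmin := isMinimalAt_cmFamily hℓ h5 v
  have h2 : 2 ≤ ((cmFamily ℓ).baseChange ℚ).conductorExponent v := by
    refine two_le_conductorExponent_of_dvd_Δ_of_dvd_c₄ hmin ?_ ?_
    · rw [hv, ← pow_one ((ℓ : ℕ) : ℤ), pow_dvd_cmFamily_Δ_iff, pow_one]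
      exact dvd_mul_of_dvd_right (dvd_pow_self ℓ (by norm_num)) _
    · rw [hv, cmFamily_c₄]; exact dvd_zero _
  have hfac : (((cmFamily ℓ).baseChange ℚ).conductorNorm ℤ).factorization ℓ =
      ((cmFamily ℓ).baseChange ℚ).conductorExponent v := by
    rw [show ℓ = ((⟨ℓ, hℓ⟩ : Nat.Primes) : ℕ) from rfl, factorization_conductorNorm_primesEquiv_symm,
      show (primesEquiv (R := ℤ)).symm ⟨ℓ, hℓ⟩ = v from
        (primesEquiv (R := ℤ)).symm_apply_eq.mpr (Subtype.ext hv.symm)]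
  exact (hℓ.pow_dvd_iff_le_factorization hN0).mpr (by omega)

/-- Conductor bounds in `ℝ`: `ℓ² ≤ N ≤ 432 ℓ²`. -/
theorem conductorNorm_cmFamily_bounds (hℓ : ℓ.Prime) (h5 : 5 ≤ ℓ) :
    ((ℓ : ℝ)) ^ 2 ≤ ((((cmFamily ℓ).baseChange ℚ).conductorNorm ℤ : ℕ) : ℝ) ∧
      ((((cmFamily ℓ).baseChange ℚ).conductorNorm ℤ : ℕ) : ℝ) ≤ 432 * ((ℓ : ℝ)) ^ 2 := by
  haveI := isElliptic_cmFamily hℓ.ne_zero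
  constructor
  · exact_mod_cast Nat.le_of_dvd (conductorNorm_pos_holds _) (sq_dvd_conductorNorm_cmFamily hℓ h5)
  · have h := Nat.le_of_dvd (by positivity) (conductorNorm_cmFamily_dvd hℓ h5)
    have : (((cmFamily ℓ).baseChange ℚ).conductorNorm ℤ : ℕ) ≤ 432 * ℓ ^ 2 := by
      calc _ ≤ 2 ^ 4 * 3 ^ 3 * ℓ ^ 2 := h
        _ = 432 * ℓ ^ 2 := by norm_num
    exact_mod_cast this

/-- `M⁺ = max(|Δ|, |c₄|³) = 432 ℓ¹⁰`. -/
theorem maxInv_cmFamily (ℓ : ℕ) :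
    max |(cmFamily ℓ).Δ| (|(cmFamily ℓ).c₄| ^ 3) = 432 * (ℓ : ℤ) ^ 10 := by
  rw [cmFamily_Δ, cmFamily_c₄, abs_neg, abs_of_nonneg (by positivity), abs_zero]
  norm_num

/-! ### The mutated window set (CM-`j` exclusion dropped) -/

/-- The crux's window slice with the CM-`j` exclusion `c₄ ≠ 0 ∧ c₆ ≠ 0` dropped. -/
def windowSetCM (κ σ X : ℝ) : Set (WeierstrassCurve ℤ) :=
  {W₀ : WeierstrassCurve ℤ | (W₀.baseChange ℚ).IsElliptic ∧
    (∀ v : IsDedekindDomain.HeightOneSpectrum ℤ, (W₀.baseChange ℚ).IsMinimalAt v) ∧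
    (W₀.a₁ = 0 ∨ W₀.a₁ = 1) ∧ (W₀.a₃ = 0 ∨ W₀.a₃ = 1) ∧ (W₀.a₂ = -1 ∨ W₀.a₂ = 0 ∨ W₀.a₂ = 1) ∧
    (((W₀.baseChange ℚ).conductorNorm ℤ : ℕ) : ℝ) ≤ X ∧
    (((W₀.baseChange ℚ).conductorNorm ℤ : ℕ) : ℝ) ^ κ ≤ ((max |W₀.Δ| (|W₀.c₄| ^ 3) : ℤ) : ℝ) ∧
    ((max |W₀.Δ| (|W₀.c₄| ^ 3) : ℤ) : ℝ) ≤ (((W₀.baseChange ℚ).conductorNorm ℤ : ℕ) : ℝ) ^ σ}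

/-- The mutated crux: `SomeWindowSaving` with the CM-`j` exclusion dropped. -/
def SomeWindowSavingWithoutCM : Prop :=
  ∃ κ σ δ C : ℝ, 3 < κ ∧ κ < σ ∧ δ < (σ - κ) / (2 * σ - 6) ∧
    ∀ X : ℝ, 1 ≤ X → ((windowSetCM κ σ X).ncard : ℝ) ≤ C * X ^ δ

/-- The genuine slice sits inside the mutated one. -/
theorem windowSet_subset_windowSetCM (κ σ X : ℝ) : windowSet κ σ X ⊆ windowSetCM κ σ X := by
  rintro W ⟨hE, hmin, ha₁, ha₃, ha₂, -, -, hN, hlo, hhi⟩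
  exact ⟨hE, hmin, ha₁, ha₃, ha₂, hN, hlo, hhi⟩

end CMFamily

end Summit.ABC.ABC.Theorems.SomeWindowSaving.Negative
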